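import Mathlib
import HarnessLib

/-!
# Crux `DescentPerfectToAll` (stmt-ResolutionOfSingularities-0549) — lens 5, g9: PORT-READY step (V) of THEOREM T
# («no best `p`-th power approximation ⇒ every non-zero element of the `K^p`-line of `g₀` has the value of a `p`-th power»,
#  proved INSIDE `K`, i.e. in the currency of the lead's stub `stub_cleanLU3DefectNonDiscrete` — no extension field `L = K(g₀^{1/p})`)

SUPPORT workfile (res-B-lens-5 g9, 2026-08-29).  OURS · counted 0.  Nothing here proves resolution in characteristic `p`; no crux or
stub is proved here.  Memo `CLASSBC-prank2-toric-lens5-g9.md` §1 uses (V) «`v(M^×) ⊆ v((K^×)^p)` for `M = K^p(g₀)` when `L/K` is immediate»;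
with `L` the proof is one line (`m = ℓ^p`, `w(ℓ) ∈ Γ`).  Here it is done without `L`, from the stub's hypothesis `hdefect` alone:
* `exists_valuation_eq_pow_of_pow_eq` ✓ — Bezout on values: `v (m^n) = v (w^p)` with `0 < n < p` ⇒ `v m = v (z^p)` for some `z ≠ 0`;
* `valuation_pthPower_mul_pow_ne` ✓ — if `v m` is NOT a `p`-th-power value, the values `v (α^p m^i)`, `i < p`, are pairwise distinct
  for distinct `i` (`α ≠ 0`);
* `exists_valuation_eq_pthPower_of_noBestApprox` ✓ — MAIN: `(∀ c, c^p ≠ g₀)` is not even needed; from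
  `hdefect : ∀ f₀, ∃ f₁, v (g₀ - f₁^p) < v (g₀ - f₀^p)` alone, every NON-ZERO `m = ∑_{j<p} c_j^p g₀^j` has `v m = v (z^p)` for some `z ≠ 0`.
  Proof: if not, `{m^i}_{i<p}` is graded, hence linearly independent over the subfield `F = K^p` (= `(frobenius K p).fieldRange`);
  the `F`-span `V` of `{g₀^j}_{j<p}` has `finrank ≤ p`, is stable under multiplication by `g₀` (as `g₀^p ∈ F`) hence by `m`, so it
  contains the `p` independent powers `m^i`, which therefore span it: `g₀ = ∑ α_i^p m^i`.  Then for every `f`,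
  `g₀ - f^p = (α₀ - f)^p + ∑_{i ≥ 1} α_i^p m^i` is a graded sum whose value is `≥ v(∑_{i≥1} α_i^p m^i) = v(g₀ - α₀^p)`: `α₀` is a
  best approximation, contradicting `hdefect`.
* section `SpanPowers` ✓ — the `K^p`-line `V(g₀) = span_{K^p}{g₀^j : j<p}` is a SUBFIELD (`exists_subfield_pthPowers_adjoin`: def-free
  «`∃ M : Subfield K, x ∈ M ↔ ∃ c, ∑ c_j^p g₀^j = x`»; closure under `*` from `g₀^p ∈ K^p`, under `⁻¹` by injective ⇒ surjective on the
  finite-dimensional `V(g₀)`), `finrank ≤ p`, membership lemmas; `exists_subfield_immediate_values` ✓ packages (V) as the hypothesis `hV` of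
  `Lens5_GradedBasis.monomial_values_ne`.
* section `Degree` ✓ — `[K^p(g₀) : K^p] = p` for `g₀ ∉ K^p` (`minpoly = X^p − g₀^p` by the Kummer criterion over the field `K^p`),
  membership `x ∈ K^p⟮g₀⟯ ↔ ∃ c, ∑ c_j^p g₀^j = x`, and — GIVEN the named fact `hdeg : [K : K^p] = p³` (p-degree of a separably generated
  function field of transcendence degree 3; MacLane; not in Mathlib, not proved here) — `[K : K^p(g₀)] = p²`
  (`exists_subfield_pthPowers_adjoin_finrank` ✓) + the glue `exists_repr_of_linearIndependent_card_eq` ✓: with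
  `Lens5_GradedBasis.monomials_linearIndependent` this is the SPANNING half of (PB) modulo `hdeg` alone.
The three lemmas of the section `Copied` are VERBATIM from `Lens5_GradedBasis.lean` (204cad92bbab; being ported by the lead's worker as
`Theorems/RadicialJungCleanModelsLens5GradedBasis.lean`) — on port, import that file and delete the section.  Def-free; Mathlib only.
Resolution of singularities in positive characteristic is NOT proved.
-/

noncomputable section

set_option linter.dupNamespace false

open Module

namespace Summit.ResolutionOfSingularities.ResolutionOfSingularities.Cruxes.DescentPerfectToAll.CpSibling.ImmediateValues

variable {K : Type} [Field K] {Γ₀ : Type} [LinearOrderedCommGroupWithZero Γ₀]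

section Copied

/-- (copied from `Lens5_GradedBasis`) If the non-zero terms of a finite sum have pairwise distinct values, the value of the sum is
the largest value. [folklore] -/
theorem valuation_sum_eq_sup_of_pairwise (v : Valuation K Γ₀) {ι : Type} [DecidableEq ι] (s : Finset ι) (f : ι → K)
    (h : ∀ i ∈ s, ∀ j ∈ s, i ≠ j → f i ≠ 0 → v (f i) ≠ v (f j)) :
    v (∑ i ∈ s, f i) = s.sup (fun i => v (f i)) := by
  rcases s.eq_empty_or_nonempty with rfl | hne
  · simp [bot_eq_zero]
  obtain ⟨j, hj, hmax⟩ := Finset.exists_max_image s (fun i => v (f i)) hne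
  have hsup : s.sup (fun i => v (f i)) = v (f j) :=
    le_antisymm (Finset.sup_le fun i hi => hmax i hi) (Finset.le_sup (f := fun i => v (f i)) hj)
  rw [hsup]
  by_cases hfj : f j = 0
  · have hall : ∀ i ∈ s, f i = 0 := by
      intro i hi
      have hle := hmax i hi
      rw [hfj, map_zero] at hle
      exact (Valuation.zero_iff v).mp (le_antisymm hle zero_le)
    rw [Finset.sum_eq_zero hall, hfj]
  · rw [← Finset.add_sum_erase s f hj]
    have hlt : v (∑ i ∈ s.erase j, f i) < v (f j) := by
      refine v.map_sum_lt ((Valuation.ne_zero_iff v).mpr hfj) fun i hi => ?_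
      have hij : i ≠ j := Finset.ne_of_mem_erase hi
      have his : i ∈ s := Finset.mem_of_mem_erase hi
      rcases (hmax i his).lt_or_eq with hlt | heq
      · exact hlt
      · exfalso
        by_cases hfi : f i = 0
        · rw [hfi, map_zero] at heq
          exact hfj ((Valuation.zero_iff v).mp heq.symm)
        · exact h i his j hj hij hfi heq
    rw [Valuation.map_add_eq_of_lt_left v hlt]

/-- (copied from `Lens5_GradedBasis`) A graded sum vanishes only if every term vanishes. [folklore] -/
theorem eq_zero_of_sum_eq_zero_of_pairwise (v : Valuation K Γ₀) {ι : Type} [DecidableEq ι] (s : Finset ι) (f : ι → K)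
    (h : ∀ i ∈ s, ∀ j ∈ s, i ≠ j → f i ≠ 0 → v (f i) ≠ v (f j)) (hsum : ∑ i ∈ s, f i = 0) :
    ∀ i ∈ s, f i = 0 := by
  intro i hi
  have hsup := valuation_sum_eq_sup_of_pairwise v s f h
  rw [hsum, map_zero] at hsup
  have hle : v (f i) ≤ s.sup (fun i => v (f i)) := Finset.le_sup (f := fun i => v (f i)) hi
  rw [← hsup] at hle
  exact (Valuation.zero_iff v).mp (le_antisymm hle zero_le)

/-- (copied from `Lens5_GradedBasis`) A finite family `b` of non-zero elements such that `v (m · b i) ≠ v (m' · b j)` whenever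
`i ≠ j` and `m, m'` are non-zero elements of a subfield `M` is linearly independent over `M`. [folklore] -/
theorem linearIndependent_of_valuation_pairwise (v : Valuation K Γ₀) (M : Subfield K) {ι : Type} [Fintype ι] [DecidableEq ι]
    (b : ι → K) (hb : ∀ i, b i ≠ 0)
    (h : ∀ i j, i ≠ j → ∀ m m' : K, m ∈ M → m' ∈ M → m ≠ 0 → m' ≠ 0 → v (m * b i) ≠ v (m' * b j)) :
    LinearIndependent M b := by
  rw [Fintype.linearIndependent_iff]
  intro g hg i
  have hsum : ∑ i, (g i : K) * b i = 0 := by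
    have : ∑ i, (g i : K) * b i = ∑ i, g i • b i :=
      Finset.sum_congr rfl fun i _ => (Subfield.smul_def (g i) (b i)).symm
    rw [this, hg]
  have hpw : ∀ i ∈ (Finset.univ : Finset ι), ∀ j ∈ (Finset.univ : Finset ι), i ≠ j → (g i : K) * b i ≠ 0 →
      v ((g i : K) * b i) ≠ v ((g j : K) * b j) := by
    intro i _ j _ hij hi0
    have hgi : (g i : K) ≠ 0 := fun h0 => hi0 (by rw [h0, zero_mul])
    by_cases hgj : (g j : K) = 0
    · rw [hgj, zero_mul, map_zero]
      exact (Valuation.ne_zero_iff v).mpr hi0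
    · exact h i j hij (g i) (g j) (g i).2 (g j).2 hgi hgj
  have h0 := eq_zero_of_sum_eq_zero_of_pairwise v Finset.univ (fun i => (g i : K) * b i) hpw hsum i (Finset.mem_univ i)
  rcases mul_eq_zero.mp h0 with h1 | h1
  · exact_mod_cast h1
  · exact absurd h1 (hb i)

end Copied

section SpanPowers

/-! ### The `K^p`-line `V(g₀) := span_{K^p} {g₀^j : j < p}` (`K^p = (frobenius K p).fieldRange`) is the subfield `K^p(g₀)` -/

variable {p : ℕ} [hp : Fact p.Prime] [CharP K p]

theorem pow_mem_fieldRange_frobenius (x : K) : x ^ p ∈ (frobenius K p).fieldRange :=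
  RingHom.mem_fieldRange.mpr ⟨x, frobenius_def p x⟩

theorem exists_pow_eq_of_mem_fieldRange_frobenius {a : K} (ha : a ∈ (frobenius K p).fieldRange) : ∃ α : K, α ^ p = a := by
  obtain ⟨α, hα⟩ := RingHom.mem_fieldRange.mp ha
  exact ⟨α, by rw [← hα, frobenius_def]⟩

theorem one_mem_span_powers (g₀ : K) :
    (1 : K) ∈ Submodule.span (frobenius K p).fieldRange (Set.range fun j : Fin p => g₀ ^ (j : ℕ)) :=
  Submodule.subset_span ⟨⟨0, hp.out.pos⟩, pow_zero g₀⟩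

theorem self_mem_span_powers (g₀ : K) :
    g₀ ∈ Submodule.span (frobenius K p).fieldRange (Set.range fun j : Fin p => g₀ ^ (j : ℕ)) :=
  Submodule.subset_span ⟨⟨1, hp.out.one_lt⟩, pow_one g₀⟩

/-- `dim_{K^p} V(g₀) ≤ p`. -/
theorem finrank_span_powers_le (g₀ : K) :
    finrank (frobenius K p).fieldRange (Submodule.span (frobenius K p).fieldRange (Set.range fun j : Fin p => g₀ ^ (j : ℕ))) ≤ p := by
  have h := finrank_range_le_card (R := (frobenius K p).fieldRange) (fun j : Fin p => g₀ ^ (j : ℕ))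
  simpa [Set.finrank] using h

/-- `V(g₀)` is stable under multiplication by `g₀` (because `g₀^p ∈ K^p`). -/
theorem self_mul_mem_span_powers (g₀ : K) {x : K}
    (hx : x ∈ Submodule.span (frobenius K p).fieldRange (Set.range fun j : Fin p => g₀ ^ (j : ℕ))) :
    g₀ * x ∈ Submodule.span (frobenius K p).fieldRange (Set.range fun j : Fin p => g₀ ^ (j : ℕ)) := by
  set V := Submodule.span (frobenius K p).fieldRange (Set.range fun j : Fin p => g₀ ^ (j : ℕ)) with hV_def
  refine Submodule.span_induction (p := fun x _ => g₀ * x ∈ V) ?_ ?_ ?_ ?_ hx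
  · rintro x ⟨j, rfl⟩
    by_cases hj : (j : ℕ) + 1 < p
    · exact Submodule.subset_span ⟨⟨(j : ℕ) + 1, hj⟩, by simp [pow_succ, mul_comm]⟩
    · have hjp : (j : ℕ) + 1 = p := by omega
      have hgp : g₀ * g₀ ^ (j : ℕ) = g₀ ^ p := by rw [← pow_succ', hjp]
      rw [hgp]
      have : g₀ ^ p = (⟨g₀ ^ p, pow_mem_fieldRange_frobenius g₀⟩ : (frobenius K p).fieldRange) • (1 : K) := by
        rw [Subfield.smul_def, smul_eq_mul, mul_one]
      rw [this]
      exact V.smul_mem _ (one_mem_span_powers g₀)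
  · simp
  · intro x y _ _ hx hy
    rw [mul_add]
    exact V.add_mem hx hy
  · intro a x _ hx
    rw [Subfield.smul_def, smul_eq_mul, mul_left_comm]
    have : (a : K) * (g₀ * x) = a • (g₀ * x) := by rw [Subfield.smul_def, smul_eq_mul]
    rw [this]
    exact V.smul_mem a hx

/-- `V(g₀)` is closed under multiplication. -/
theorem mul_mem_span_powers (g₀ : K) {x y : K}
    (hx : x ∈ Submodule.span (frobenius K p).fieldRange (Set.range fun j : Fin p => g₀ ^ (j : ℕ)))
    (hy : y ∈ Submodule.span (frobenius K p).fieldRange (Set.range fun j : Fin p => g₀ ^ (j : ℕ))) :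
    x * y ∈ Submodule.span (frobenius K p).fieldRange (Set.range fun j : Fin p => g₀ ^ (j : ℕ)) := by
  set V := Submodule.span (frobenius K p).fieldRange (Set.range fun j : Fin p => g₀ ^ (j : ℕ)) with hV_def
  have hpow : ∀ n : ℕ, ∀ z ∈ V, g₀ ^ n * z ∈ V := by
    intro n
    induction n with
    | zero => intro z hz; simpa using hz
    | succ n ih => intro z hz; rw [pow_succ, mul_assoc]; exact ih _ (self_mul_mem_span_powers g₀ hz)
  obtain ⟨a, rfl⟩ := (Submodule.mem_span_range_iff_exists_fun _).mp hx
  rw [Finset.sum_mul]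
  refine V.sum_mem fun j _ => ?_
  have : (a j • g₀ ^ (j : ℕ)) * y = a j • (g₀ ^ (j : ℕ) * y) := by
    rw [Subfield.smul_def, Subfield.smul_def, smul_eq_mul, smul_eq_mul, mul_assoc]
  rw [this]
  exact V.smul_mem _ (hpow j y hy)

/-- `V(g₀)` is closed under inverses (an injective `K^p`-linear endomorphism of the finite-dimensional `V(g₀)` is surjective). -/
theorem inv_mem_span_powers (g₀ : K) {x : K}
    (hx : x ∈ Submodule.span (frobenius K p).fieldRange (Set.range fun j : Fin p => g₀ ^ (j : ℕ))) :
    x⁻¹ ∈ Submodule.span (frobenius K p).fieldRange (Set.range fun j : Fin p => g₀ ^ (j : ℕ)) := by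
  set V := Submodule.span (frobenius K p).fieldRange (Set.range fun j : Fin p => g₀ ^ (j : ℕ)) with hV_def
  by_cases hx0 : x = 0
  · rw [hx0, inv_zero]; exact V.zero_mem
  haveI : Module.Finite (frobenius K p).fieldRange V := Module.Finite.span_of_finite _ (Set.finite_range _)
  let f : V →ₗ[(frobenius K p).fieldRange] V :=
    { toFun := fun y => ⟨x * y, mul_mem_span_powers g₀ hx y.2⟩
      map_add' := fun y y' => by ext; simp [mul_add]
      map_smul' := fun a y => by
        ext
        simp only [Submodule.coe_smul_of_tower, RingHom.id_apply, Subfield.smul_def, smul_eq_mul]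
        ring }
  have hinj : Function.Injective f := by
    intro y y' h
    have h' : x * (y : K) = x * (y' : K) := congrArg Subtype.val h
    exact Subtype.ext (mul_left_cancel₀ hx0 h')
  obtain ⟨y, hy⟩ := (LinearMap.injective_iff_surjective.mp hinj) ⟨1, one_mem_span_powers g₀⟩
  have hxy : x * (y : K) = 1 := congrArg Subtype.val hy
  rw [inv_eq_of_mul_eq_one_right hxy]
  exact y.2

/-- Membership in `V(g₀)` in the currency of the stub: `x = ∑_{j<p} c_j^p g₀^j`. -/
theorem mem_span_powers_iff (g₀ x : K) :
    x ∈ Submodule.span (frobenius K p).fieldRange (Set.range fun j : Fin p => g₀ ^ (j : ℕ)) ↔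
      ∃ c : Fin p → K, ∑ j, c j ^ p * g₀ ^ (j : ℕ) = x := by
  rw [Submodule.mem_span_range_iff_exists_fun]
  constructor
  · rintro ⟨a, rfl⟩
    choose α hα using fun j => exists_pow_eq_of_mem_fieldRange_frobenius (a j).2
    exact ⟨α, Finset.sum_congr rfl fun j _ => by rw [hα, Subfield.smul_def, smul_eq_mul]⟩
  · rintro ⟨c, rfl⟩
    exact ⟨fun j => ⟨c j ^ p, pow_mem_fieldRange_frobenius (c j)⟩,
      Finset.sum_congr rfl fun j _ => by rw [Subfield.smul_def, smul_eq_mul]⟩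

/-- **`K^p(g₀)` as a subfield, def-free.**  There is a subfield `M` of `K` whose elements are exactly the sums `∑_{j<p} c_j^p g₀^j`
(no hypothesis on `g₀`; if `g₀ ∈ K^p` this is `K^p`). [folklore] -/
theorem exists_subfield_pthPowers_adjoin (g₀ : K) :
    ∃ M : Subfield K, ∀ x : K, x ∈ M ↔ ∃ c : Fin p → K, ∑ j, c j ^ p * g₀ ^ (j : ℕ) = x := by
  set V := Submodule.span (frobenius K p).fieldRange (Set.range fun j : Fin p => g₀ ^ (j : ℕ)) with hV_def
  refine ⟨Subfield.closure (V : Set K), fun x => ?_⟩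
  rw [← mem_span_powers_iff]
  constructor
  · intro hx
    refine Subfield.closure_induction (p := fun x _ => x ∈ V) (fun x hx => hx) (one_mem_span_powers g₀)
      (fun x y _ _ hx hy => V.add_mem hx hy) (fun x _ hx => V.neg_mem hx) (fun x _ hx => inv_mem_span_powers g₀ hx)
      (fun x y _ _ hx hy => mul_mem_span_powers g₀ hx hy) hx
  · exact fun hx => Subfield.subset_closure hx

end SpanPowers

section Degree

/-! ### Degree: `[K^p(g₀) : K^p] = p` for `g₀ ∉ K^p`, and `[K : K^p(g₀)] = p²` under the named fact `[K : K^p] = p³`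
(MacLane / p-basis count for a separably generated function field of transcendence degree 3 — NOT proved here, taken as `hdeg`) -/

variable {p : ℕ} [hp : Fact p.Prime] [CharP K p]

open Polynomial in
/-- `X^p − g₀^p` is irreducible over `K^p` when `g₀ ∉ K^p` (Kummer criterion `X_pow_sub_C_irreducible_of_prime` over the field `K^p`:
a root `b ∈ K^p` of it would satisfy `(b − g₀)^p = 0`). [folklore] -/
theorem irreducible_X_pow_sub_C_pthPower (g₀ : K) (hg₀ : ∀ c : K, c ^ p ≠ g₀) :
    Irreducible (X ^ p - C (⟨g₀ ^ p, pow_mem_fieldRange_frobenius g₀⟩ : (frobenius K p).fieldRange)) := by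
  refine X_pow_sub_C_irreducible_of_prime hp.out fun b hb => ?_
  obtain ⟨β, hβ⟩ := exists_pow_eq_of_mem_fieldRange_frobenius (p := p) b.2
  have hbK : (b : K) ^ p = g₀ ^ p := by
    have h := congrArg Subtype.val hb
    simpa using h
  have h0 : ((b : K) - g₀) ^ p = 0 := by rw [sub_pow_char, hbK, sub_self]
  have hbg : (b : K) = g₀ := sub_eq_zero.mp ((pow_eq_zero_iff hp.out.ne_zero).mp h0)
  exact hg₀ β (by rw [hβ, hbg])

open Polynomial in
theorem aeval_X_pow_sub_C_pthPower (g₀ : K) :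
    aeval g₀ (X ^ p - C (⟨g₀ ^ p, pow_mem_fieldRange_frobenius g₀⟩ : (frobenius K p).fieldRange)) = 0 := by
  rw [map_sub, aeval_X_pow, aeval_C]
  exact sub_self _

theorem isIntegral_fieldRange_frobenius (g₀ : K) : IsIntegral (frobenius K p).fieldRange g₀ :=
  ⟨_, Polynomial.monic_X_pow_sub_C _ hp.out.ne_zero, by
    have h := aeval_X_pow_sub_C_pthPower (p := p) g₀
    rwa [Polynomial.aeval_def] at h⟩

open Polynomial in
/-- The minimal polynomial of `g₀ ∉ K^p` over `K^p` is `X^p − g₀^p`. -/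
theorem minpoly_eq_X_pow_sub_C (g₀ : K) (hg₀ : ∀ c : K, c ^ p ≠ g₀) :
    minpoly (frobenius K p).fieldRange g₀ = X ^ p - C (⟨g₀ ^ p, pow_mem_fieldRange_frobenius g₀⟩ : (frobenius K p).fieldRange) :=
  (minpoly.eq_of_irreducible_of_monic (irreducible_X_pow_sub_C_pthPower g₀ hg₀) (aeval_X_pow_sub_C_pthPower g₀)
    (monic_X_pow_sub_C _ hp.out.ne_zero)).symm

open IntermediateField in
/-- `[K^p(g₀) : K^p] = p` for `g₀ ∉ K^p`. [folklore] -/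
theorem finrank_adjoin_pthPowers_eq (g₀ : K) (hg₀ : ∀ c : K, c ^ p ≠ g₀) :
    finrank (frobenius K p).fieldRange (frobenius K p).fieldRange⟮g₀⟯ = p := by
  rw [adjoin.finrank (isIntegral_fieldRange_frobenius g₀), minpoly_eq_X_pow_sub_C g₀ hg₀, Polynomial.natDegree_X_pow_sub_C]

open IntermediateField in
/-- `[K : K^p(g₀)] = p²` for `g₀ ∉ K^p`, GIVEN the p-degree `[K : K^p] = p³` (named fact, hypothesis `hdeg`). -/
theorem finrank_over_adjoin_pthPowers_eq (g₀ : K) (hg₀ : ∀ c : K, c ^ p ≠ g₀)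
    (hdeg : finrank (frobenius K p).fieldRange K = p ^ 3) :
    finrank (frobenius K p).fieldRange⟮g₀⟯ K = p ^ 2 := by
  have htower := Module.finrank_mul_finrank (frobenius K p).fieldRange (frobenius K p).fieldRange⟮g₀⟯ K
  rw [finrank_adjoin_pthPowers_eq g₀ hg₀, hdeg] at htower
  have h : p * finrank (frobenius K p).fieldRange⟮g₀⟯ K = p * p ^ 2 := by rw [htower]; ring
  exact Nat.eq_of_mul_eq_mul_left hp.out.pos h

open Polynomial IntermediateField in
/-- Membership in `K^p(g₀)` in the currency of the stub. -/
theorem mem_adjoin_pthPowers_iff (g₀ x : K) :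
    x ∈ (frobenius K p).fieldRange⟮g₀⟯ ↔ ∃ c : Fin p → K, ∑ j, c j ^ p * g₀ ^ (j : ℕ) = x := by
  have hint := isIntegral_fieldRange_frobenius (p := p) g₀
  constructor
  · intro hx
    have hx' : x ∈ ((frobenius K p).fieldRange⟮g₀⟯).toSubalgebra := hx
    rw [adjoin_simple_toSubalgebra_of_isAlgebraic hint.isAlgebraic, Algebra.adjoin_singleton_eq_range_aeval] at hx'
    obtain ⟨q, rfl⟩ := hx'
    -- reduce `q` modulo the minimal polynomial: degree `< p`
    set r := q %ₘ minpoly (frobenius K p).fieldRange g₀ with hr_def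
    have hqr : aeval g₀ r = aeval g₀ q := aeval_modByMonic_eq_self_of_root (minpoly.aeval _ g₀)
    have hdeg_min : (minpoly (frobenius K p).fieldRange g₀).natDegree ≤ p := by
      have hdvd := minpoly.dvd (frobenius K p).fieldRange g₀ (aeval_X_pow_sub_C_pthPower g₀)
      have hne : (X ^ p - C (⟨g₀ ^ p, pow_mem_fieldRange_frobenius g₀⟩ : (frobenius K p).fieldRange)) ≠ 0 :=
        (monic_X_pow_sub_C _ hp.out.ne_zero).ne_zero
      have h := natDegree_le_of_dvd hdvd hne
      rwa [natDegree_X_pow_sub_C] at h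
    have hr_lt : r.natDegree < p :=
      lt_of_lt_of_le (natDegree_modByMonic_lt q (minpoly.monic hint) (minpoly.ne_one _ g₀)) hdeg_min
    change ∃ c : Fin p → K, ∑ j, c j ^ p * g₀ ^ (j : ℕ) = aeval g₀ q
    rw [← hqr, aeval_eq_sum_range' hr_lt, Finset.sum_range]
    choose α hα using fun i : Fin p => exists_pow_eq_of_mem_fieldRange_frobenius (p := p) (r.coeff i).2
    exact ⟨α, Finset.sum_congr rfl fun i _ => by rw [hα, Subfield.smul_def, smul_eq_mul]⟩
  · rintro ⟨c, rfl⟩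
    refine sum_mem fun j _ => mul_mem ?_ (pow_mem (mem_adjoin_simple_self _ g₀) _)
    have : c j ^ p = algebraMap (frobenius K p).fieldRange K ⟨c j ^ p, pow_mem_fieldRange_frobenius (c j)⟩ := rfl
    rw [this]
    exact IntermediateField.algebraMap_mem _ _

open IntermediateField in
/-- **`[K : K^p(g₀)] = p²`, packaged def-free** (given the p-degree `hdeg`): a subfield `M` whose elements are the sums `∑ c_j^p g₀^j`
with `finrank M K = p²`; so ANY `p²` elements of `K` linearly independent over `M` — e.g. the monomials `x^a y^b` of
`Lens5_GradedBasis.monomials_linearIndependent` — form an `M`-basis of `K` (`exists_repr_of_linearIndependent_card_eq`). -/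
theorem exists_subfield_pthPowers_adjoin_finrank (g₀ : K) (hg₀ : ∀ c : K, c ^ p ≠ g₀)
    (hdeg : finrank (frobenius K p).fieldRange K = p ^ 3) :
    ∃ M : Subfield K, (∀ x : K, x ∈ M ↔ ∃ c : Fin p → K, ∑ j, c j ^ p * g₀ ^ (j : ℕ) = x) ∧ finrank M K = p ^ 2 :=
  ⟨((frobenius K p).fieldRange⟮g₀⟯).toSubfield, fun x => mem_adjoin_pthPowers_iff g₀ x,
    finrank_over_adjoin_pthPowers_eq g₀ hg₀ hdeg⟩

/-- Glue: over a subfield `M` with `finrank M K = N`, a linearly independent family of `N` elements represents every element of `K`. -/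
theorem exists_repr_of_linearIndependent_card_eq (M : Subfield K) {N : ℕ} (hN : finrank M K = N) (hN0 : 0 < N)
    {ι : Type} [Fintype ι] (b : ι → K) (hb : LinearIndependent M b) (hcard : Fintype.card ι = N) (x : K) :
    ∃ a : ι → M, ∑ i, a i • b i = x := by
  haveI : Module.Finite M K := Module.finite_of_finrank_pos (by rw [hN]; exact hN0)
  haveI : Nonempty ι := Fintype.card_pos_iff.mp (by rw [hcard]; exact hN0)
  have hspan : Submodule.span M (Set.range b) = ⊤ := hb.span_eq_top_of_card_eq_finrank (by rw [hcard, hN])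
  have hx : x ∈ Submodule.span M (Set.range b) := by rw [hspan]; exact Submodule.mem_top
  exact (Submodule.mem_span_range_iff_exists_fun M).mp hx

end Degree

/-- **Bezout on values.** If `v (m ^ n) = v (w ^ p)` with `0 < n < p` and `p` prime, then `v m` is the value of a `p`-th power
(`n s = p t + 1` gives `v m = v ((w^s / m^t)^p)`). [folklore] -/
theorem exists_valuation_eq_pow_of_pow_eq {p : ℕ} (hp : p.Prime) (v : Valuation K Γ₀) {m w : K} (hm : m ≠ 0) (hw : w ≠ 0)
    {n : ℕ} (hn0 : 0 < n) (hnp : n < p) (h : v (m ^ n) = v (w ^ p)) :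
    ∃ z : K, z ≠ 0 ∧ v m = v (z ^ p) := by
  have hcop : Nat.Coprime n p := (Nat.coprime_of_lt_prime hn0.ne' hnp hp).symm
  obtain ⟨s, -, hs⟩ := Nat.exists_mul_mod_eq_one_of_coprime hcop hp.one_lt
  have hns : n * s = p * (n * s / p) + 1 := by
    have h1 := Nat.div_add_mod (n * s) p
    rw [hs] at h1
    exact h1.symm
  set t := n * s / p with ht
  refine ⟨w ^ s / m ^ t, div_ne_zero (pow_ne_zero _ hw) (pow_ne_zero _ hm), ?_⟩
  have h1 : v (m ^ (n * s)) = v ((w ^ s) ^ p) := by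
    rw [pow_mul, map_pow, h, ← map_pow, ← pow_mul, ← pow_mul, mul_comm]
  rw [hns, pow_succ, pow_mul', map_mul, map_pow] at h1
  -- h1 : v (m ^ t) ^ p * v m = v ((w ^ s) ^ p)
  have hvmt : v (m ^ t) ^ p ≠ 0 := pow_ne_zero _ ((Valuation.ne_zero_iff v).mpr (pow_ne_zero _ hm))
  rw [div_pow, map_div₀, map_pow v (m ^ t), eq_div_iff hvmt, mul_comm]
  exact h1

/-- **Graded powers.** If `v m` is NOT the value of a `p`-th power (`p` prime, `m ≠ 0`), then `v (α^p m^i) ≠ v (α'^p m^j)` for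
`i < j < p` and `α, α' ≠ 0`. [folklore] -/
theorem valuation_pthPower_mul_pow_ne {p : ℕ} (hp : p.Prime) (v : Valuation K Γ₀) {m : K} (hm : m ≠ 0)
    (hnot : ∀ z : K, z ≠ 0 → v m ≠ v (z ^ p)) {i j : ℕ} (hij : i < j) (hj : j < p)
    {α α' : K} (hα : α ≠ 0) (hα' : α' ≠ 0) : v (α ^ p * m ^ i) ≠ v (α' ^ p * m ^ j) := by
  intro heq
  obtain ⟨k, rfl⟩ := Nat.exists_eq_add_of_le hij.le
  have hk0 : 0 < k := by omega
  have hkp : k < p := by omega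
  rw [pow_add, map_mul, map_mul, map_mul] at heq
  -- heq : v (α ^ p) * v (m ^ i) = v (α' ^ p) * (v (m ^ i) * v (m ^ k))
  have hvα' : v (α' ^ p) ≠ 0 := (Valuation.ne_zero_iff v).mpr (pow_ne_zero _ hα')
  have hvmi : v (m ^ i) ≠ 0 := (Valuation.ne_zero_iff v).mpr (pow_ne_zero _ hm)
  have key : v (m ^ k) = v ((α / α') ^ p) := by
    rw [div_pow, map_div₀, eq_div_iff hvα']
    apply mul_right_cancel₀ hvmi
    calc v (m ^ k) * v (α' ^ p) * v (m ^ i) = v (α' ^ p) * (v (m ^ i) * v (m ^ k)) := by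
            rw [mul_comm (v (m ^ k)) (v (α' ^ p)), mul_assoc, mul_comm (v (m ^ k)) (v (m ^ i))]
      _ = v (α ^ p) * v (m ^ i) := heq.symm
  obtain ⟨z, hz0, hz⟩ := exists_valuation_eq_pow_of_pow_eq hp v hm (div_ne_zero hα hα') hk0 hkp key
  exact hnot z hz0 hz

/-- **(V) inside `K`.**  If `g₀` has NO best `p`-th power approximation (`hdefect`, the «immediate» branch of the dichotomy
`e = p ∨ f = p ∨ d = p` for `K(g₀^{1/p})/K`), then every non-zero element `m = ∑_{j<p} c_j^p g₀^j` of the `K^p`-line `K^p(g₀)` has the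
value of a `p`-th power: `v m = v (z^p)` with `z ≠ 0`.  (Memo §1 (V); with (P2) `[Γ:pΓ] = p²` this makes `{x^a y^b}` a graded
`K^p(g₀)`-basis of `K` — `Lens5_GradedBasis.monomials_linearIndependent`.) [folklore; this «inside-K» proof: ours] -/
theorem exists_valuation_eq_pthPower_of_noBestApprox {p : ℕ} [hp : Fact p.Prime] [CharP K p] (v : Valuation K Γ₀) (g₀ : K)
    (hdefect : ∀ f₀ : K, ∃ f₁ : K, v (g₀ - f₁ ^ p) < v (g₀ - f₀ ^ p))
    (c : Fin p → K) (hm0 : ∑ j, c j ^ p * g₀ ^ (j : ℕ) ≠ 0) :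
    ∃ z : K, z ≠ 0 ∧ v (∑ j, c j ^ p * g₀ ^ (j : ℕ)) = v (z ^ p) := by
  have hpp : p.Prime := hp.out
  set m := ∑ j, c j ^ p * g₀ ^ (j : ℕ) with hm_def
  by_contra H
  push Not at H
  -- H : ∀ z, z ≠ 0 → v m ≠ v (z ^ p)
  -- the subfield `F = K^p` of `p`-th powers
  set F : Subfield K := (frobenius K p).fieldRange with hF_def
  have hpowF : ∀ x : K, x ^ p ∈ F := fun x => RingHom.mem_fieldRange.mpr ⟨x, frobenius_def p x⟩
  have hFpow : ∀ a : K, a ∈ F → ∃ α : K, α ^ p = a := fun a ha => by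
    obtain ⟨α, hα⟩ := RingHom.mem_fieldRange.mp ha
    exact ⟨α, by rw [← hα, frobenius_def]⟩
  -- Step A: the powers `m^i`, `i < p`, are graded over `F`
  have hpair : ∀ i j : Fin p, i ≠ j → ∀ a a' : K, a ∈ F → a' ∈ F → a ≠ 0 → a' ≠ 0 →
      v (a * m ^ (i : ℕ)) ≠ v (a' * m ^ (j : ℕ)) := by
    intro i j hij a a' ha ha' ha0 ha'0
    obtain ⟨α, rfl⟩ := hFpow a ha
    obtain ⟨α', rfl⟩ := hFpow a' ha'
    have hα : α ≠ 0 := fun h0 => ha0 (by rw [h0, zero_pow hpp.ne_zero])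
    have hα' : α' ≠ 0 := fun h0 => ha'0 (by rw [h0, zero_pow hpp.ne_zero])
    have hij' : (i : ℕ) ≠ (j : ℕ) := Fin.val_ne_of_ne hij
    rcases Nat.lt_or_gt_of_ne hij' with hlt | hlt
    · exact valuation_pthPower_mul_pow_ne hpp v hm0 H hlt j.2 hα hα'
    · exact fun heq => valuation_pthPower_mul_pow_ne hpp v hm0 H hlt i.2 hα' hα heq.symm
  -- Step B: linear independence over `F`
  have hLI : LinearIndependent F (fun i : Fin p => m ^ (i : ℕ)) :=
    linearIndependent_of_valuation_pairwise v F (fun i : Fin p => m ^ (i : ℕ)) (fun i => pow_ne_zero _ hm0) hpair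
  -- Step C: the `F`-span `V` of the powers of `g₀` has `finrank ≤ p`, contains every `m^i`, hence is spanned by them
  set V : Submodule F K := Submodule.span F (Set.range fun j : Fin p => g₀ ^ (j : ℕ)) with hV_def
  haveI : Module.Finite F V := Module.Finite.span_of_finite F (Set.finite_range _)
  have hVfin : finrank F V ≤ p := finrank_span_powers_le g₀
  have hg₀V : g₀ ∈ V := self_mem_span_powers g₀
  have hmV : m ∈ V := (mem_span_powers_iff g₀ m).mpr ⟨c, rfl⟩
  have hmpow : ∀ n : ℕ, m ^ n ∈ V := by
    intro n
    induction n with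
    | zero => simpa using one_mem_span_powers (p := p) g₀
    | succ n ih => rw [pow_succ]; exact mul_mem_span_powers g₀ ih hmV
  -- the family `m^i` inside `V` is independent and has `p = finrank V` members, so it spans `V`
  set b : Fin p → V := fun i => ⟨m ^ (i : ℕ), hmpow i⟩ with hb_def
  have hbLI : LinearIndependent F b := by
    apply LinearIndependent.of_comp V.subtype
    exact hLI
  have hcard : Fintype.card (Fin p) = finrank F V :=
    le_antisymm (hbLI.fintype_card_le_finrank) (by simpa using hVfin)
  haveI : Nonempty (Fin p) := ⟨⟨0, hpp.pos⟩⟩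
  have hspan : Submodule.span F (Set.range b) = ⊤ := hbLI.span_eq_top_of_card_eq_finrank hcard
  have hg₀span : (⟨g₀, hg₀V⟩ : V) ∈ Submodule.span F (Set.range b) := by rw [hspan]; exact Submodule.mem_top
  obtain ⟨a, ha⟩ := (Submodule.mem_span_range_iff_exists_fun F).mp hg₀span
  -- ha : ∑ i, a i • b i = ⟨g₀, _⟩ ; read it in `K`
  have haK : ∑ i, (a i : K) * m ^ (i : ℕ) = g₀ := by
    have := congrArg Subtype.val ha
    simpa [hb_def, Subfield.smul_def] using this
  -- Step D: `α₀` with `α₀^p = a 0` is a best approximation — contradiction with `hdefect`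
  set j0 : Fin p := ⟨0, hpp.pos⟩ with hj0_def
  obtain ⟨α₀, hα₀⟩ := hFpow (a j0) (a j0).2
  set T := ∑ i ∈ (Finset.univ : Finset (Fin p)).erase j0, (a i : K) * m ^ (i : ℕ) with hT_def
  have hgT : g₀ - α₀ ^ p = T := by
    rw [← haK, ← Finset.add_sum_erase Finset.univ (fun i => (a i : K) * m ^ (i : ℕ)) (Finset.mem_univ j0), hα₀]
    simp [hj0_def, hT_def]
  -- graded reading of `g₀ - f^p` for an arbitrary `f`
  have hbound : ∀ f : K, v T ≤ v (g₀ - f ^ p) := by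
    intro f
    -- coefficients of `g₀ - f^p` in the basis `m^i`
    let a' : Fin p → K := fun i => if i = j0 then (α₀ - f) ^ p else (a i : K)
    have ha'F : ∀ i, a' i ∈ F := by
      intro i
      by_cases hi : i = j0
      · simp only [a', hi, if_true]; exact hpowF _
      · simp only [a', hi, if_false]; exact (a i).2
    have hpw : ∀ i ∈ (Finset.univ : Finset (Fin p)), ∀ j ∈ (Finset.univ : Finset (Fin p)), i ≠ j →
        a' i * m ^ (i : ℕ) ≠ 0 → v (a' i * m ^ (i : ℕ)) ≠ v (a' j * m ^ (j : ℕ)) := by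
      intro i _ j _ hij hi0
      have hai : a' i ≠ 0 := fun h0 => hi0 (by rw [h0, zero_mul])
      by_cases haj : a' j = 0
      · rw [haj, zero_mul, map_zero]
        exact (Valuation.ne_zero_iff v).mpr hi0
      · exact hpair i j hij (a' i) (a' j) (ha'F i) (ha'F j) hai haj
    have hpw' : ∀ i ∈ (Finset.univ : Finset (Fin p)).erase j0, ∀ j ∈ (Finset.univ : Finset (Fin p)).erase j0, i ≠ j →
        a' i * m ^ (i : ℕ) ≠ 0 → v (a' i * m ^ (i : ℕ)) ≠ v (a' j * m ^ (j : ℕ)) :=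
      fun i _ j _ hij hi0 => hpw i (Finset.mem_univ i) j (Finset.mem_univ j) hij hi0
    have hTsum : T = ∑ i ∈ (Finset.univ : Finset (Fin p)).erase j0, a' i * m ^ (i : ℕ) := by
      refine Finset.sum_congr rfl fun i hi => ?_
      have hij : i ≠ j0 := Finset.ne_of_mem_erase hi
      simp only [a', hij, if_false]
    have hdiff : g₀ - f ^ p = ∑ i, a' i * m ^ (i : ℕ) := by
      rw [← Finset.add_sum_erase Finset.univ (fun i => a' i * m ^ (i : ℕ)) (Finset.mem_univ j0), ← hTsum, ← hgT]
      simp only [a', if_true, hj0_def]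
      rw [sub_pow_char]
      ring
    rw [hdiff, hTsum, valuation_sum_eq_sup_of_pairwise v _ _ hpw, valuation_sum_eq_sup_of_pairwise v _ _ hpw']
    exact Finset.sup_mono (Finset.erase_subset j0 Finset.univ)
  obtain ⟨f₁, hf₁⟩ := hdefect α₀
  rw [hgT] at hf₁
  exact absurd (hbound f₁) (not_le.mpr hf₁)

/-- **(V), packaged.**  Under `hdefect` the subfield `M = K^p(g₀)` (elements `∑_{j<p} c_j^p g₀^j`) satisfies
`v(M^×) ⊆ v((K^×)^p)` — the hypothesis `hV` of `Lens5_GradedBasis.monomial_values_ne` / `monomials_linearIndependent`. -/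
theorem exists_subfield_immediate_values {p : ℕ} [hp : Fact p.Prime] [CharP K p] (v : Valuation K Γ₀) (g₀ : K)
    (hdefect : ∀ f₀ : K, ∃ f₁ : K, v (g₀ - f₁ ^ p) < v (g₀ - f₀ ^ p)) :
    ∃ M : Subfield K, (∀ x : K, x ∈ M ↔ ∃ c : Fin p → K, ∑ j, c j ^ p * g₀ ^ (j : ℕ) = x) ∧ g₀ ∈ M ∧
      (∀ x : K, x ^ p ∈ M) ∧ ∀ m : K, m ∈ M → m ≠ 0 → ∃ z : K, z ≠ 0 ∧ v m = v (z ^ p) := by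
  obtain ⟨M, hM⟩ := exists_subfield_pthPowers_adjoin (p := p) g₀
  refine ⟨M, hM, ?_, ?_, ?_⟩
  · rw [hM, ← mem_span_powers_iff]
    exact self_mem_span_powers g₀
  · intro x
    rw [hM, ← mem_span_powers_iff]
    have : x ^ p = (⟨x ^ p, pow_mem_fieldRange_frobenius x⟩ : (frobenius K p).fieldRange) • (1 : K) := by
      rw [Subfield.smul_def, smul_eq_mul, mul_one]
    rw [this]
    exact Submodule.smul_mem _ _ (one_mem_span_powers g₀)
  · intro m hm hm0
    obtain ⟨c, rfl⟩ := (hM m).mp hm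
    exact exists_valuation_eq_pthPower_of_noBestApprox v g₀ hdefect c hm0

end Summit.ResolutionOfSingularities.ResolutionOfSingularities.Cruxes.DescentPerfectToAll.CpSibling.ImmediateValues

end
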